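import Mathlib
import HarnessLib
import HarnessLib.Audit
import Summits.KontsevichZagierPeriods.Statement
import HarnessLib.Audit.Status.Attr

/-!
Route: LinkTwistWrithe

DORMANT since 2026-08-23T16:58:55Z (reconciler: no traction for 6.1 d (last activity item-proof-filed at 2026-08-17T13:05:34Z); parked, not closed — `ledger route dormant route-KontsevichZagierPeriods-LinkTwistWrithe --off` to reactivat) — unstaffed, not closed; items shared with open routes are served there. `ledger route dormant <id> --off` reactivates.

# Route LinkTwistWrithe — Link = Twist + Writhe inside the rules — degree is a move, so Gauss
linking, Călugăreanu–White–Fuller and Whitehead integrals of algebraic knots compile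

It suffices to show X = DegreeTransfer ∧ DegreeKernel (card
link-twist-writhe-configuration-integrals, realised as ENGINE + enlarged kernel, with the
knot-theoretic identities as its ranked rungs). DegreeTransfer (ENGINE, "degree is a move"): a
finite family of SIGNED sheets (σ_k, Φ_k, ε_k ∈ ℤ) of ℚ-semialgebraic injective differentiable maps
into the domain τ of a representation [τ, g], whose signed sheet count Σ_k ε_k·1_{Φ_k(σ_k)} equals
an integer d almost everywhere on τ, gives the relation [⋃σ_k, Σ_k ε_k 1_{σ_k}(g∘Φ_k)|det Φ_k′|] −
d·[τ, g] ∈ KZ.relations — the mapping-degree / area formula with sign and PARTIAL images (sheets of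
a folding Gauss map), derived from rules 1a, 1b, 2 alone (no primitive). DegreeKernel (TARGET):
Conjecture 1 for the calculus enlarged by these signed-degree relators. The information of the line
is in the rungs, which are theorems of topology with INTEGER answers read as typed KZ identities:
WrithePlusTorsion (rank 2: 4π·Wr(K) + 2∮_K τ ds = 4π·SL(K) = 0 for the algebraic curve K = {x²+y²=1,
z=y(1+x)} — a 2-dimensional and a 1-dimensional period of the same curve summing to an integer),
GaussLinkingHopfLink (rank 3: the Gauss integral of two linked algebraic circles is KZ-equivalent to
the area 4π of a disc), HopfInvariantScaling (rank 5, informal at open: Whitehead's integral obeys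
H(g_k∘h) = k²·H(h) inside the rules because Grothendieck's algebraic de Rham theorem makes the
primitive α algebraic on the affine quadric S³), with supports ArchimedesCoV (the area form of S² is
ONE change of variables away from the flat disc of radius 2) and ThreeSphereVolume (vol S³ = 2π²
through the Hopf map as a change of variables).
Lean: `DegreeTransfer ∧ DegreeKernel` — decls of this route file; every item below elaborates in the
planner folder Sketch.lean (lean check rc 0, 2026-08-15), where `theorem assembly_holds : Assembly`
is PROVED (AddSubgroup.closure_le; axioms propext/Classical.choice/Quot.sound).

## Assembly
Pure algebra, PROVED in the planner's Sketch.lean (theorem assembly_holds, 12 lines, a prover may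
copy it): AddSubgroup.closure_le with KZ.domainAddRel_subset_relations,
KZ.integrandAddRel_subset_relations, KZ.newtonLeibnizRel_subset_relations and DegreeTransfer for the
fourth generating set gives closure(enlarged generators) ≤ KZ.relations; with DegreeKernel this is
ker eval ≤ relations = Literature.NumberTheory.Transcendental.KZKernelConjecture, and
Summit.KontsevichZagierPeriods.KernelForm.kontsevichZagierPeriods_of_kzKernelConjecture
(Theorems/KernelFormKernelImpliesStatement.lean) yields the summit. The ranked rungs
WrithePlusTorsion, GaussLinkingHopfLink, HopfInvariantScaling are CONSEQUENCES of the summit (their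
two sides have equal values by theorems of topology), hence test-beds: each is necessary for
KontsevichZagierPeriods and each is proved through DegreeTransfer + ArchimedesCoV + Newton–Leibniz
with the algebraic primitive β.

Rationale: WHY THIS LINE. Every integral formula of knot theory with an integer value — Gauss linking (4π·Lk =
∬ Γ*dA), Călugăreanu–White–Fuller (Lk = Tw + Wr: Pohl1968, White1969, Fuller1971, Fuller1978,
DennisHannay2005; Kauffman1991 p. 281 writes Wr = (1/4π)∫_{S²} Cr(z) dz with Cr the SIGNED Jacobian
count of the Gauss map e : C×C → S²), Whitehead's Hopf integral (Whitehead1947, ArnoldKhesin1998) —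
is, for ℚ-algebraic curves and maps in rational parametrisation, an identity between absolutely
convergent integrals of ℚ-semialgebraic functions over ℚ-semialgebraic domains, i.e. an instance of
Conjecture 1 (KontsevichZagier2001 §1.2) whose truth is a theorem of topology and whose
transcendental content is only [S², dA] ~ 4π; nobody has pointed configuration-space integrals
(BottTaubes1994, ChmutovDuzhinMostovoy2012) at the period conjecture, and Kontsevich–Zagier never
mention knots. The classical PROOFS are degree theory (sheet counting of the Gauss map, degree with
boundary along the tantrix) plus Gauss–Bonnet on spherical polygons, and both transcribe into the
fixed H21 calculus WITHOUT transcendental primitives: degree is signed sheet transfer (rules 1a, 1b,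
2 — the engine DegreeTransfer, which strictly generalises MultivaluedCoV's unsigned SheetTransfer,
stmt-KontsevichZagierPeriods-2877, to folding maps), the area form in the stereographic chart has
the ALGEBRAIC primitive β = 2(x dy − y dx)/(1+x²+y²) (dβ = 4 dx∧dy/(1+r²)², and −β is the
Levi-Civita connection form of the conformal frame, so along the tantrix T*β = ±(τ ds − dθ)
pointwise, θ the chart angle of T′), and turning numbers ∮dθ = 2π·rot are again degrees in dimension
1 — so the only moves are additivity, change of variables and two Newton–Leibniz steps with
primitives β_x, β_y. Imported areas: differential topology of curves and configuration-space
integrals (the identities and their degree proofs), real semialgebraic geometry (BCR1998: images,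
Boolean atoms of sheet images, Nash sheets), and — for the Hopf rung — Grothendieck's algebraic de
Rham theorem for smooth AFFINE varieties (Grothendieck1966 Thm 1′, Hartshorne1975): H¹ = H² = 0 of
the complexified quadric Σz_i² = 1 makes Whitehead's primitive α regular algebraic, the positive
counterpart (closed affine pieces) of the primitive barrier. What the line does that no open route
does: a transcendence-free, motive-free sector of Conjecture 1 in dimensions 1–3 with certified
integer answers, whose failure would be a defect of the fixed calculus visible in dimension 2 (and a
concrete Neg witness), and whose engine (signed degree) is reusable by every route that meets a
non-injective algebraic change of variables.

RANKED CRUXES. #0 DegreeKernel (target) — Conjecture 1 for the calculus ENLARGED by signed-degree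
relators: every formal ℤ-combination of integral representations with value 0 lies in the subgroup
generated by domain additivity (1a), integrand additivity (1b), Newton–Leibniz (3) and the relators
[⋃σ_k, Σ_k ε_k 1_{σ_k}(g∘Φ_k)|det Φ_k′|] − d·[τ, g] of finite signed sheet families with
a.e.-constant signed count d (a rule-2 instance is the one-sheet relator). Honest status: modulo
DegreeTransfer it is EQUIVALENT to Literature.NumberTheory.Transcendental.KZKernelConjecture
(GPC-strength; the strength barriers bite here and only here); filed so that the engine is
load-bearing in the Assembly. (why it might fail: GPC-strength: equivalent to KZKernelConjecture
modulo DegreeTransfer; false iff some equal-valued pair is underivable (route Neg's bets: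
Gauss-triplication pair, regularised MZV relations).) [KontsevichZagier2001, HuberMullerStach2017,
Ayoub2015]
#2 WrithePlusTorsion (crux) — LINK = TWIST + WRITHE for the ℚ-algebraic space curve K = {x² + y² =
1, z = y(1 + x)} (rational parametrisation u = tan(t/2): c = (1−u²)/(1+u²), s = 2u/(1+u²), p(u) =
(c, s, s + sc); curvature ≥ 0.2 > 0, so the Frenet ribbon is defined; Frenet self-linking number SL
= 0, certified numerically: 4π·Wr = 1.0383817, ∮τ ds = −0.5191906, 4π·Wr + 2∮τ ds = 4.5e−7). Claim:
for the writhe representation r₂ = [{u ≠ v} ⊂ ℝ², W] with W(u,v) = (1+c)(1+c′)·det(p(u) − p(v),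
p_t(u), p_t(v))/|p(u) − p(v)|³ (Gauss integrand = pull-back of dA_{S²} by the secant map; continuous
and bounded, O(|u−v|) at the diagonal) and the torsion representation r₁ = [ℝ, T] with T(u) =
(1+c)|p_t| det(p_t, p_tt, p_ttt)/|p_t × p_tt|² = τ·ds/du, one has KZ.of r₂ + 2 • KZ.of r₁ ∈
KZ.relations (i.e. 4π(Wr + Tw_Frenet) = 4π·SL = 0 as a finite chain of moves). Suggested chain
(Pohl's degree-with-boundary proof, transcribed): signed DegreeTransfer of the secant map Γ̃ =
stereo ∘ Γ on {u>v} and {u<v} onto the Boolean atoms R_J of S² ∖ (tantrix ∪ antitantrix) with their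
integer counts; on each atom [R_J, 4/(1+ρ²)²] = [R_J, ∂_x β_y] + [R_J, −∂_y β_x] (β = 2(x dy − y
dx)/(1+ρ²)) and two Newton–Leibniz moves give 1-dim reps on arcs of ±T; along T, ⟨β∘T̃, T̃′⟩ =
±(τ|p_t|(1+c) − θ′) POINTWISE (sign = orientation convention) (−β is the connection form of the
conformal frame; geodesic curvature of the tantrix × its speed = τ ds); [ℝ, θ′] is 2π·(turning
number) by DegreeTransfer in dimension 1 onto [ℝ, 2/(1+w²)]; the integers cancel to SL = 0 so no
π-representation survives. [deps: DegreeTransfer, ArchimedesCoV] [difficulty: XL] (why it might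
fail: The integer 0 must come out of signed sheet counts of a degree-16 secant map, jumps across the
tantrix and turning numbers, all as explicit ℚ-semialgebraic cells; if a cell resists presentation
the fallback (integrate a variable out) meets a solid-angle primitive — not semialgebraic.)
[Pohl1968, White1969, Fuller1971, Fuller1978, DennisHannay2005, Kauffman1991, KontsevichZagier2001]
#3 GaussLinkingHopfLink (crux) — GAUSS LINKING IS A DEGREE (card W1, refuter-checked instance). The
Hopf link of two round ℚ-circles C₁ = {x²+y²=1, z=0} (p(u) = (c, s, 0)) and C₂ = {(x−1)²+z²=1, y=0}
oriented so that Lk = +1 (q(v) = (1+c′, 0, −s′)); distance between the circles ≥ 1, so the Gauss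
integrand G(u,v) = (1+c)(1+c′)·det(p − q, p_t, q_t)/|p − q|³ is smooth, bounded and
O((1+u²)⁻¹(1+v²)⁻¹): ∬_{ℝ²} G = 4π·Lk = 4π (numerics: 1.0000 × 4π). Claim: the representation [ℝ²,
G] is KZ-EQUIVALENT to [{w₀² + w₁² < 4}, 1] (area of the disc of radius 2). Suggested chain: G =
Γ̃*(4 dx dy/(1+ρ²)²) for the secant map Γ̃ = stereo ∘ (p − q)/|p − q| : ℝ² → ℝ²; sheets = the cells
of {G ≠ 0} cut by the fold curve {G = 0} on which Γ̃ is injective (sign ε = sign G); signed count =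
deg = 1 a.e.; DegreeTransfer gives [ℝ², G] − 1·[ℝ², 4/(1+ρ²)²] ∈ relations, and ArchimedesCoV
finishes. The torus must fold (no covering T² → S²), so this is the smallest honest instance of
degree-with-folds in the tree. [deps: DegreeTransfer, ArchimedesCoV] [difficulty: L] (why it might
fail: Γ̃ : T² → S² must fold, so even Lk = 1 needs the fold curve {G = 0} and counts 1 = 2 − 1 as
explicit ℚ-semialgebraic injectivity cells of a degree-8 rational map; integrating out one circle
instead hits the solid angle of a circle (elliptic integrals) — no semialgebraic primitive.)
[Kauffman1991, White1969, KontsevichZagier2001, BCR1998]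
#4 DegreeTransfer (crux) — THE ENGINE — DEGREE IS A MOVE (signed sheet transfer; card compiler (D)).
Data: r, r′ : IntegralRep n; sheets σ_k ⊆ r.domain (k < N) ℚ-semialgebraic with r.domain ∖ ⋃σ_k null
(sheets may overlap); maps Φ_k ℚ-semialgebraic on σ_k, injective, with HasFDerivWithinAt derivative
Φ_k′ within σ_k, images inside r′.domain; integer weights ε_k; HYPOTHESIS: the signed count y ↦ Σ_k
ε_k·1_{Φ_k(σ_k)}(y) equals the integer d for a.e. y ∈ r′.domain; integrand identity on ⋃σ_k:
r.integrand = Σ_k 1_{σ_k}·ε_k·(r′.integrand∘Φ_k)·|det Φ_k′|. Conclusion: KZ.of r − d • KZ.of r′ ∈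
KZ.relations. With ε ≡ 1 and co-null images this is MultivaluedCoV's SheetTransfer
(stmt-KontsevichZagierPeriods-2877, d = N); the new content is signs and PARTIAL images, i.e. the
degree of a folding map (linking number, writhe sheet count Cr(z), turning number). Derivation
inside the rules (no primitive, no Hardt triviality needed): the Boolean atoms R_J = r′.domain ∩
⋂_{k∈J} Φ_k(σ_k) ∩ ⋂_{k∉J} Φ_k(σ_k)ᶜ (J ⊆ Fin N) are ℚ-semialgebraic (images:
IsSemialgebraicMapOn.isSemialgebraic_image) and partition r′.domain; on a non-null atom Σ_{k∈J} ε_k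
= d; [σ_k ∩ Φ_k⁻¹R_J, ε_k(g∘Φ_k)|det|] − ε_k·[R_J, g] ∈ relations by one change of variables and
integrand additivity ([R, f] + [R, −f] ~ [R, 0] ~ 0); null atoms and null remainders are relations
([Z] = [Z] + [Z]); integrand additivity peels the N summands (partial sums are IntegralReps: toolkit
add/mul/indicator lemmas, integrability from r′.integrableOn by
MeasureTheory.integrableOn_image_iff_integrableOn_abs_det_fderiv_smul); domain additivity
reassembles both sides. [difficulty: L] (why it might fail: The value identity is the area formula,
so failure is as-typed only: overlapping sheets and partial images force intermediate reps Σ_{k<j}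
1_{σ_k} h_k and Boolean atoms of images whose semialgebraicity/integrability must come from toolkit
lemmas; a missing side condition falsifies the ∀.) [BCR1998, KontsevichZagier2001,
HuberMullerStach2017, Kauffman1991]
#9 ArchimedesCoV (support) — ARCHIMEDES' HAT-BOX THEOREM IS ONE MOVE OF RULE 2: the area density of
S² in the stereographic chart, [ℝ², 4/(1+|w|²)²], and the flat disc of radius 2, [{|w| < 2}, 1],
differ by a single changeOfVariablesRel instance, Φ(w) = 2w/√(1+|w|²) (inverse stereographic
projection followed by Lambert's azimuthal equal-area map; a Nash diffeomorphism ℝ² → open disc of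
radius 2 with |det Φ′| = 4/(1+|w|²)², graph {(w, y) : |y|²(1+|w|²) = 4|w|², y ∥ w, same direction}
ℚ-semialgebraic). This is the normalisation [S², dA] ~ 4π used by GaussLinkingHopfLink and by every
degree computation onto the sphere; provable now from the toolkit (IsSemialgebraicMapOn via the
polynomial graph, HasFDerivWithinAt of a C^∞ map, InjOn, image = open disc, Jacobian identity).
[difficulty: provable-now] [KontsevichZagier2001, BCR1998]
#9 ThreeSphereVolume (support) — vol(S³) = 2π² INSIDE THE RULES, the normalisation of the Hopf rung
(Whitehead's ∫α₁∧h*ω is a rational multiple of it): the round volume density of S³ in the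
stereographic chart, [ℝ³, 8/(1+|x|²)³], minus twice the product of two unit discs, 2•[{w₀²+w₁²<1 ∧
w₂²+w₃²<1} ⊂ ℝ⁴, 1], lies in KZ.relations. Suggested chain: the HOPF MAP with its fibre angle, x ↦
(stereo(h(x)), tan(ψ/2)), is ONE ℚ-semialgebraic change of variables on a co-null open set ℝ³ → ℝ² ×
ℝ carrying 8/(1+|x|²)³ to 2/((1+ρ²)²(1+w²)) (base S²(1/2) × fibre); ArchimedesCoV on the base factor
gives [B(0,2) × ℝ, 1/(2(1+w²))]; on the fibre factor KZ's printed π-chain (w = tan-half-angle change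
of variables, Newton–Leibniz with primitive y from the half-disc, reflection) reaches [B(0,2) × D⁺,
1] and scaling/reflection moves give 2•[D × D, 1]. First dimension-3/4 derivation in the tree;
failure would refute the summit. [difficulty: M] [Whitehead1947, ArnoldKhesin1998,
KontsevichZagier2001]

TWO-LAYER PLAN. Foreseen glued splits (k ≤ 3, depth 1; nothing filed now): WrithePlusTorsion ⇐
WritheSheetCount (signed DegreeTransfer of the secant map onto the atoms of S² ∖ ±T: [r₂] ~ Σ_J n_J
[R_J, 4/(1+ρ²)²]) → TantrixGaussBonnet (Σ_J n_J [R_J, dA] + 2[ℝ, T] ~ m•[ℝ, 2/(1+w²)] by the two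
Newton–Leibniz moves with β_x, β_y and the pointwise identity T*β = ±(τ ds − dθ)) →
TurningNumbersCancel (m = 0 by 1-dim DegreeTransfer) → WrithePlusTorsion. GaussLinkingHopfLink ⇐
HopfLinkSheets (the fold curve {G = 0} and injectivity cells, count = 1 a.e.) → DegreeTransfer
instance → ArchimedesCoV. DegreeTransfer ⇐ AtomDecomposition (Boolean atoms of the images are
ℚ-semialgebraic and carry constant counts) → SignedSheetCoV (one sheet over one atom, with sign) →
bookkeeping. HopfInvariantScaling (informal, rank 5) is typed by set-signature once β₂ (regular
algebraic 1-form on the real quadric with g₂*ω − 2ω = dβ₂) is written down; then split as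
CrossTermsExact → ZeroBulkStokesOnS3 (three Newton–Leibniz moves after compactifying the chart axes)
→ scaling.

KILL CRITERIA. Refuting WrithePlusTorsion, GaussLinkingHopfLink, ArchimedesCoV or ThreeSphereVolume
AS VALUE IDENTITIES is impossible (theorems of topology, numerically certified); refuting any of
them AS KZ STATEMENTS refutes the SUMMIT (an additive invariant of FormalRep killing the four move
sets but separating a topological identity) — report to the operator as a calculus defect, close
this route `refuted:<Decl>` and hand the witness to route Neg (its obstruction-shape item) as the
cheapest known Neg test-bed (dimension 2, no arithmetic). Refuting DegreeTransfer as typed (a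
side-condition slip) forces a restate, not a close. If DegreeTransfer is proved but the sheet
presentations of the two Gauss maps stall for two tenure cycles, pivot the rungs to the ε-RIBBON
form (Lk(K, K+εN) as a pure degree of a map between closed surfaces, CWF as an endpoint statement ε
→ 0 handed to card limit-is-a-move). DegreeKernel proved elsewhere (any kernel-form route) moots the
route; SheetTransfer (stmt-2877) proved first makes DegreeTransfer's unsigned half support.

NOT DECOMPOSED YET. The explicit fold curves / injectivity cells of the two secant maps (layer-2
children of the rank-2 and rank-3 cruxes, found by the prover or a kit job); the general
'Newton–Leibniz with boundary terms on a CAD-decomposed planar region' lemma (the rungs only need it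
for the explicit atoms R_J; the frontier-zero version is GaussManinCertificates' KZStokes,
stmt-KontsevichZagierPeriods-3012, which does not serve here because the boundary terms are the
point); the 1-dim turning-number instance of DegreeTransfer; KZ's printed π-chain [ℝ, 1/(1+w²)] ~
[D, 1] (LowDimension calibration); the Hopf rung's explicit β₂ and the general affine algebraic de
Rham fact (definition request); the next rung BottTaubesV2 (order-2 configuration-space integral of
an algebraic knot = v₂ + const: principal faces are integrand identities, hidden faces need the
log-corner regularisation of card log-corner-deregularisation-functor, doi:10.5802/jep.335) —
deliberately NOT an item.

CHEAPEST FALSIFIER. Two cheap checks, both run this session: (i) the value identities — pure-python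
quadrature in the planner folder (num/): 4π·Wr + 2∮τ ds = 4.5e−7 for K (N = 1500), Gauss integral of
the oriented Hopf link = 4π·(1.0000), min distance of the circles = 1, κ_min(K) = 0.200, and the
Lean let-chains transliterated symbol-for-symbol reproduce the same numbers (6.5e−7); (ii)
elaboration — all six statements and the assembly proof typecheck (lean check rc 0). The cheapest
REMAINING falsifier is conceptual and takes an hour by hand: verify that the secant map of the Hopf
link has signed count exactly 1 on a co-null set with finitely many ℚ-semialgebraic injectivity
cells (compute the discriminant of {G = 0}); if the fold set were non-algebraic in (u, v) the degree
chain would die — it cannot be, since G is a rational function times an algebraic square root, but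
the cell count decides Difficulty L vs XL.

NUMBERS. K = {x²+y²=1, z=y(1+x)}: κ_min = 0.200, 4π·Wr = 1.0383817 (Wr = 0.08263), ∮τ ds =
−0.5191906 (Tw_Frenet = −0.08263), SL = 0; family (cos t, sin t, a sin t + (b/2) sin 2t): SL = 0 for
all (a,b) ∈ {(½,½),(½,1),(1,½),(¼,½),(1,1)}, Wr = 0 iff ab = 0 (achiral cases). Hopf link: ∬G =
+12.566 = 4π with C₂ oriented (1+c′, 0, −s′) (−4π with +s′); min |p − q| = 1. Sphere normalisations:
∬_{ℝ²} 4/(1+ρ²)² = 4π = area B(0,2); ∭_{ℝ³} 8/(1+|x|²)³ = 2π² = 2·area(D)². Items at open: 7 typed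
(target, assembly, 3 cruxes, 2 supports) + 1 informal crux (HopfInvariantScaling, rank 5) filed
right after open.

DEFINITION REQUESTS. Filed after open, for the informal Hopf rung: (D1) definition
`AffineAlgebraicDeRham` — for a smooth real affine variety X ⊂ ℝⁿ cut out by ℚ-polynomials (spheres
Σx_i² = 1 first), 'regular algebraic k-form on X' (polynomial coefficient forms modulo the ideal and
its differentials) and the named fact: a closed regular form whose class vanishes in H^k(X(ℂ)^an; ℂ)
is d of a regular form (Grothendieck1966 Thm 1′; Hartshorne1975 II.6) — topic
Literature/AlgebraicGeometry/Motives. No definition is needed by any typed item (their primitives β,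
α₁ are explicit).

Novelty: Searches (2026-08-15): `lit search --hybrid "Calugareanu White Fuller linking number writhe twist
closed space curve"` (12 held books; book:kauffman1991-knots-physics pp. 281–282 READ: White's
formula with Wr = (1/4π)∫_{S²}Cr(z)dz, Cr = signed Jacobian count — the raw material of
DegreeTransfer; book:chmutov2012-introduction-vassiliev-knot-invariants: configuration-space
integrals); `lit search --source zbmath "Calugareanu writhe twist linking"` (4: DennisHannay2005 =
doi:10.1098/rspa.2005.1527, MoffattRicca1992 = doi:10.1098/rspa.1992.0159, Hannay 1998,
arXiv:math-ph/0507039 — geometric proofs, none rules-level); `lit search --source zbmath "writhe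
period Kontsevich Zagier"` (0); `lit galaxy search "writhe Kontsevich-Zagier period" --star all` (0
in panama/pdf/crabby); `lit galaxy search "Gauss linking integral is a period" --star all` (0;
pdf/crabby queue timeout); `lit search --source arxiv|openalex|s2 …` HTTP 429 all session (recorded
in NOTES); `lit frontier KontsevichZagierPeriods --since 2021` (30 rows: MZV/odd zeta/GPC for Kummer
surfaces/log corners — nothing knot-theoretic); `lit bridges KontsevichZagierPeriods --cross any`
(nothing knot-theoretic); in-tree: the ten Theses files of the sub-problem grep'd for
linking|writhe|Hopf|tantrix (0) and `lean search` (no degree/transfer relator other than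
MultivaluedCoV.SheetTransfer, unsigned, co-null images).
Nearest prior art found: Pohl1968 / White1969 / Fuller1971 / Fuller1978 / DennisHannay2005 (the
theorem Lk = Tw + Wr  [refs: 10.1098/rspa.2005.1527, 10.1098/rspa.1992.0159, math-ph/0507039, book:kauffman1991-knots-physics, book:chmutov2012-introduction-vassiliev-knot-invariants, doi:10.1098/rspa.2005.1527, doi:10.1098/rspa.1992.0159, DennisHannay2005, MoffattRicca1992, Pohl1968, White1969, Fuller1971, Fuller1978, Kauffman1991, Whitehead1947, ArnoldKhesin1998, BottTaubes1994, ChmutovDuzhinMostovoy2012, Grothendieck1966, ]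

Barriers (technique_class: configuration-integrals; signed-degree; algebraic-de-rham): - technique_class: configuration-integrals; signed-degree; algebraic-de-rham
- Literature.Barriers.KontsevichZagierPeriods.noSemialgebraicPrimitive_inv_sub_two: evaded by
construction — no rung integrates a variable out against a transcendental primitive: degree steps
use rules 1a/1b/2 only, and the two Newton–Leibniz steps on spherical atoms use the ALGEBRAIC
primitives β_x = −2y/(1+ρ²), β_y = 2x/(1+ρ²) of the area form (for the Hopf rung, Grothendieck1966
guarantees algebraic primitives on the affine quadrics S², S³); the why-might-fail lines name
exactly where a prover who abandons the degree chain would meet the barrier (solid angle of a circle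
= elliptic integrals).
- Literature.Barriers.KontsevichZagierPeriods.cressonViuSos_prop_3_2: respected — DegreeTransfer
dissects the source into sheets and Boolean atoms and discards null sets before mapping (scissors
kept); ArchimedesCoV is one global map but between OPEN 2-cells (ℝ² → open disc), where the
Hauptvermutung hypothesis (compact polyhedra, dimension ≥ 5) is vacuous.
- Literature.Barriers.KontsevichZagierPeriods.kzConjecture_implies_oddZetaAlgIndep: bites ONLY the
target DegreeKernel (GPC-strength, said openly in its docstring); every crux/support is an
unconditional statement about specific representations whose values are equal by theorems of
topology, with no independence content (values in ℚ·π^k).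
- Literature.Barriers.KontsevichZagierPeriods.kzConjecture_implies_twoPiI_log_algIndep: same —
touches DegreeKernel onl

History (route lifecycle, newest last):
- 2026-08-15T11:45:50Z · rev 1: dropped stmt-KontsevichZagierPeriods-5315 — housekeeping: drop duplicate informal item HopfInvariantScaling (stmt-5315) created by an accidental double workitem add; stmt-KontsevichZagierPeriods-5246 (sam (planner-plancard-KontsevichZagierPeriods-Kont-9806b0d5-0)
- 2026-08-16T02:18:01Z · AUTO-CRUX: 1 conjecture-grade item(s) promoted to crux (DegreeKernel) — refuter vetting / tiering apply (operator:999:1362873)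
- 2026-08-16T04:09:01Z · AUTO-CRUX (backfill): DegreeKernel — hypotheses of the deciding theorem that nothing in the route derives are cruxes (operator:999:1085951)
- 2026-08-23T16:58:55Z · DORMANT — reconciler: no traction for 6.1 d (last activity item-proof-filed at 2026-08-17T13:05:34Z); parked, not closed — `ledger route dormant route-KontsevichZagierPer (operator:999:3345248)

sub-problem: KontsevichZagierPeriods · status: dormant · opened planner-plancard-KontsevichZagierPeriods-Kont-9806b0d5-0 2026-08-15T11:32:26Z · rev 1 · ledger route-KontsevichZagierPeriods-LinkTwistWrithe
GENERATED by the gate from the ledger (D-0016/17). Provers cite these decls: `theorem foo : Summit.KontsevichZagierPeriods.KontsevichZagierPeriods.Theses.LinkTwistWrithe.<Decl> := …` in Summits/KontsevichZagierPeriods/KontsevichZagierPeriods/Theorems/<Name>.lean.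
-/

namespace Summit.KontsevichZagierPeriods.KontsevichZagierPeriods.Theses.LinkTwistWrithe

open scoped BigOperators Topology Manifold Classical MeasureTheory ProbabilityTheory Matrix InnerProductSpace ComplexConjugate ContinuousMap
open Filter Set Function TopologicalSpace MeasureTheory

attribute [summit_statement] _root_.KontsevichZagierPeriods

open Literature Periods

/-- item stmt-KontsevichZagierPeriods-4303 · crux (kind.auto-crux: conjecture-grade) · rank 0 · open · by planner
why it might fail: GPC-strength: equivalent to KZKernelConjecture modulo DegreeTransfer; false iff some equal-valued pair is underivable (route Neg's bets: Gauss-triplication pair, regularised MZV relations).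
sources: KontsevichZagier2001, HuberMullerStach2017, Ayoub2015
[target] Conjecture 1 for the calculus ENLARGED by signed-degree relators: every formal
ℤ-combination of integral representations with value 0 lies in the subgroup generated by domain
additivity (1a), integrand additivity (1b), Newton–Leibniz (3) and the relators [⋃σ_k, Σ_k ε_k
1_{σ_k}(g∘Φ_k)|det Φ_k′|] − d·[τ, g] of finite signed sheet families with a.e.-constant signed count
d (a rule-2 instance is the one-sheet relator). Honest status: modulo DegreeTransfer it is
EQUIVALENT to Literature.NumberTheory.Transcendental.KZKernelConjecture (GPC-strength; the strength
barriers bite here and only here); filed so that the engine is load-bearing in the Assembly. -/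
@[route_item "route-KontsevichZagierPeriods-LinkTwistWrithe", crux]
def DegreeKernel : Prop :=
  ∀ c : Literature.NumberTheory.Transcendental.KZ.FormalRep, Literature.NumberTheory.Transcendental.KZ.eval c = 0 → c ∈ AddSubgroup.closure (Literature.NumberTheory.Transcendental.KZ.domainAddRel ∪ Literature.NumberTheory.Transcendental.KZ.integrandAddRel ∪ Literature.NumberTheory.Transcendental.KZ.newtonLeibnizRel ∪ {c | ∃ (n N : ℕ) (d : ℤ) (ε : Fin N → ℤ) (r r' : Literature.NumberTheory.Transcendental.KZ.IntegralRep n) (σ : Fin N → Set (Fin n → ℝ)) (Φ : Fin N → (Fin n → ℝ) → (Fin n → ℝ)) (Φ' : Fin N → (Fin n → ℝ) → ((Fin n → ℝ) →L[ℝ] (Fin n → ℝ))), (∀ k, Literature.ModelTheory.ExponentialFields.IsSemialgebraic ℚ (σ k)) ∧ (∀ k, σ k ⊆ r.domain) ∧ MeasureTheory.volume (r.domain \ ⋃ k, σ k) = 0 ∧ (∀ k, Literature.NumberTheory.Transcendental.IsSemialgebraicMapOn ℚ (σ k) (Φ k)) ∧ (∀ k, ∀ x ∈ σ k, HasFDerivWithinAt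 (Φ k) (Φ' k x) (σ k) x) ∧ (∀ k, Set.InjOn (Φ k) (σ k)) ∧ (∀ k, Φ k '' σ k ⊆ r'.domain) ∧ (∀ᵐ y ∂(MeasureTheory.volume.restrict r'.domain), (∑ k : Fin N, (Φ k '' σ k).indicator (fun _ => ε k) y) = d) ∧ (∀ x ∈ ⋃ k, σ k, r.integrand x = ∑ k : Fin N, (σ k).indicator (fun y => (ε k : ℝ) * (r'.integrand (Φ k y) * |(Φ' k y).det|)) x) ∧ c = Literature.NumberTheory.Transcendental.KZ.of r - d • Literature.NumberTheory.Transcendental.KZ.of r'})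

/-- item stmt-KontsevichZagierPeriods-4304 · crux · rank 2 · open · by planner
why it might fail: The integer 0 must come out of signed sheet counts of a degree-16 secant map, jumps across the tantrix and turning numbers, all as explicit ℚ-semialgebraic cells; if a cell resists presentation the fallback (integrate a variable out) meets a solid-angle primitive — not semialgebraic.
sources: Pohl1968, White1969, Fuller1971, Fuller1978, DennisHannay2005, Kauffman1991
[crux] LINK = TWIST + WRITHE for the ℚ-algebraic space curve K = {x² + y² = 1, z = y(1 + x)}
(rational parametrisation u = tan(t/2): c = (1−u²)/(1+u²), s = 2u/(1+u²), p(u) = (c, s, s + sc);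
curvature ≥ 0.2 > 0, so the Frenet ribbon is defined; Frenet self-linking number SL = 0, certified
numerically: 4π·Wr = 1.0383817, ∮τ ds = −0.5191906, 4π·Wr + 2∮τ ds = 4.5e−7). Claim: for the writhe
representation r₂ = [{u ≠ v} ⊂ ℝ², W] with W(u,v) = (1+c)(1+c′)·det(p(u) − p(v), p_t(u),
p_t(v))/|p(u) − p(v)|³ (Gauss integrand = pull-back of dA_{S²} by the secant map; continuous and
bounded, O(|u−v|) at the diagonal) and the torsion representation r₁ = [ℝ, T] with T(u) = (1+c)|p_t|
det(p_t, p_tt, p_ttt)/|p_t × p_tt|² = τ·ds/du, one has KZ.of r₂ + 2 • KZ.of r₁ ∈ KZ.relations (i.e.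
4π(Wr + Tw_Frenet) = 4π·SL = 0 as a finite chain of moves). Suggested chain (Pohl's
degree-with-boundary proof, transcribed): signed DegreeTransfer of the secant map Γ̃ = stereo ∘ Γ on
{u>v} and {u<v} onto the Boolean atoms R_J of S² ∖ (tantrix ∪ antitantrix) with their integer
counts; on each atom [R_J, 4/(1+ρ²)²] = [R_J, ∂_x β_y] + [R_J, −∂_y β_x] (β = 2(x dy − y dx)/(1+ρ²))
and two Newton–Leibniz moves give 1-dim reps -/
@[route_item "route-KontsevichZagierPeriods-LinkTwistWrithe"]
def WrithePlusTorsion : Prop :=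
  ∀ (r₂ : Literature.NumberTheory.Transcendental.KZ.IntegralRep 2) (r₁ : Literature.NumberTheory.Transcendental.KZ.IntegralRep 1), r₂.domain = {z : Fin 2 → ℝ | z 0 ≠ z 1} → Set.EqOn r₂.integrand (fun z : Fin 2 → ℝ => let u := z 0; let v := z 1; let c := (1 - u ^ 2) / (1 + u ^ 2); let s := 2 * u / (1 + u ^ 2); let c' := (1 - v ^ 2) / (1 + v ^ 2); let s' := 2 * v / (1 + v ^ 2); let d0 := c - c'; let d1 := s - s'; let d2 := (s + s * c) - (s' + s' * c'); let a0 := -s; let a1 := c; let a2 := c + c ^ 2 - s ^ 2; let b0 := -s'; let b1 := c'; let b2 := c' + c' ^ 2 - s' ^ 2; (1 + c) * (1 + c') * (d0 * (a1 * b2 - a2 * b1) - d1 * (a0 * b2 - a2 * b0) + d2 * (a0 * b1 - a1 * b0)) / Real.sqrt (d0 ^ 2 + d1 ^ 2 + d2 ^ 2) ^ 3) r₂.domain → r₁.domain = Set.univ → Set.EqOn r₁.integrand (fun z : Fin 1 → ℝ => let u := z 0; let c := (1 - u ^ 2) / (1 + u ^ 2); let s := 2 * u / (1 + u ^ 2);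 let a0 := -s; let a1 := c; let a2 := c + c ^ 2 - s ^ 2; let e0 := -c; let e1 := -s; let e2 := -s - 4 * s * c; let g0 := s; let g1 := -c; let g2 := -c - 4 * (c ^ 2 - s ^ 2); let k0 := a1 * e2 - a2 * e1; let k1 := a2 * e0 - a0 * e2; let k2 := a0 * e1 - a1 * e0; (1 + c) * Real.sqrt (a0 ^ 2 + a1 ^ 2 + a2 ^ 2) * (k0 * g0 + k1 * g1 + k2 * g2) / (k0 ^ 2 + k1 ^ 2 + k2 ^ 2)) r₁.domain → Literature.NumberTheory.Transcendental.KZ.of r₂ + 2 • Literature.NumberTheory.Transcendental.KZ.of r₁ ∈ Literature.NumberTheory.Transcendental.KZ.relations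

/-- item stmt-KontsevichZagierPeriods-4305 · crux · rank 3 · open · by planner
why it might fail: Γ̃ : T² → S² must fold, so even Lk = 1 needs the fold curve {G = 0} and counts 1 = 2 − 1 as explicit ℚ-semialgebraic injectivity cells of a degree-8 rational map; integrating out one circle instead hits the solid angle of a circle (elliptic integrals) — no semialgebraic primitive.
sources: Kauffman1991, White1969, KontsevichZagier2001, BCR1998
[crux] GAUSS LINKING IS A DEGREE (card W1, refuter-checked instance). The Hopf link of two round
ℚ-circles C₁ = {x²+y²=1, z=0} (p(u) = (c, s, 0)) and C₂ = {(x−1)²+z²=1, y=0} oriented so that Lk =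
+1 (q(v) = (1+c′, 0, −s′)); distance between the circles ≥ 1, so the Gauss integrand G(u,v) =
(1+c)(1+c′)·det(p − q, p_t, q_t)/|p − q|³ is smooth, bounded and O((1+u²)⁻¹(1+v²)⁻¹): ∬_{ℝ²} G =
4π·Lk = 4π (numerics: 1.0000 × 4π). Claim: the representation [ℝ², G] is KZ-EQUIVALENT to [{w₀² +
w₁² < 4}, 1] (area of the disc of radius 2). Suggested chain: G = Γ̃*(4 dx dy/(1+ρ²)²) for the
secant map Γ̃ = stereo ∘ (p − q)/|p − q| : ℝ² → ℝ²; sheets = the cells of {G ≠ 0} cut by the fold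
curve {G = 0} on which Γ̃ is injective (sign ε = sign G); signed count = deg = 1 a.e.;
DegreeTransfer gives [ℝ², G] − 1·[ℝ², 4/(1+ρ²)²] ∈ relations, and ArchimedesCoV finishes. The torus
must fold (no covering T² → S²), so this is the smallest honest instance of degree-with-folds in the
tree. [deps: DegreeTransfer, ArchimedesCoV] [difficulty: L] -/
@[route_item "route-KontsevichZagierPeriods-LinkTwistWrithe"]
def GaussLinkingHopfLink : Prop :=
  ∀ (r r' : Literature.NumberTheory.Transcendental.KZ.IntegralRep 2), r.domain = Set.univ → Set.EqOn r.integrand (fun z : Fin 2 → ℝ => let u := z 0; let v := z 1; let c := (1 - u ^ 2) / (1 + u ^ 2); let s := 2 * u / (1 + u ^ 2); let c' := (1 - v ^ 2) / (1 + v ^ 2); let s' := 2 * v / (1 + v ^ 2); let d0 := c - 1 - c'; let d1 := s; let d2 := s'; let a0 := -s; let a1 := c; let a2 := (0 : ℝ); let b0 := -s'; let b1 := (0 : ℝ); let b2 := -c'; (1 + c) * (1 + c') * (d0 * (a1 * b2 - a2 * b1) - d1 * (a0 * b2 - a2 * b0) + d2 * (a0 * b1 - a1 * b0)) / Real.sqrt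 (d0 ^ 2 + d1 ^ 2 + d2 ^ 2) ^ 3) r.domain → r'.domain = {w : Fin 2 → ℝ | w 0 ^ 2 + w 1 ^ 2 < 4} → Set.EqOn r'.integrand (fun _ => (1 : ℝ)) r'.domain → Literature.NumberTheory.Transcendental.KZ.Equivalent r r'

/-- item stmt-KontsevichZagierPeriods-4306 · crux · rank 4 · open · by planner
why it might fail: The value identity is the area formula, so failure is as-typed only: overlapping sheets and partial images force intermediate reps Σ_{k<j} 1_{σ_k} h_k and Boolean atoms of images whose semialgebraicity/integrability must come from toolkit lemmas; a missing side condition falsifies the ∀.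
sources: BCR1998, KontsevichZagier2001, HuberMullerStach2017, Kauffman1991
[crux] THE ENGINE — DEGREE IS A MOVE (signed sheet transfer; card compiler (D)). Data: r, r′ :
IntegralRep n; sheets σ_k ⊆ r.domain (k < N) ℚ-semialgebraic with r.domain ∖ ⋃σ_k null (sheets may
overlap); maps Φ_k ℚ-semialgebraic on σ_k, injective, with HasFDerivWithinAt derivative Φ_k′ within
σ_k, images inside r′.domain; integer weights ε_k; HYPOTHESIS: the signed count y ↦ Σ_k
ε_k·1_{Φ_k(σ_k)}(y) equals the integer d for a.e. y ∈ r′.domain; integrand identity on ⋃σ_k: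
r.integrand = Σ_k 1_{σ_k}·ε_k·(r′.integrand∘Φ_k)·|det Φ_k′|. Conclusion: KZ.of r − d • KZ.of r′ ∈
KZ.relations. With ε ≡ 1 and co-null images this is MultivaluedCoV's SheetTransfer
(stmt-KontsevichZagierPeriods-2877, d = N); the new content is signs and PARTIAL images, i.e. the
degree of a folding map (linking number, writhe sheet count Cr(z), turning number). Derivation
inside the rules (no primitive, no Hardt triviality needed): the Boolean atoms R_J = r′.domain ∩
⋂_{k∈J} Φ_k(σ_k) ∩ ⋂_{k∉J} Φ_k(σ_k)ᶜ (J ⊆ Fin N) are ℚ-semialgebraic (images: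
IsSemialgebraicMapOn.isSemialgebraic_image) and partition r′.domain; on a non-null atom Σ_{k∈J} ε_k
= d; [σ_k ∩ Φ_k⁻¹R_J, ε_k(g∘Φ_k)|det|] − ε_k·[R_J, g] ∈ relations by one cha -/
@[route_item "route-KontsevichZagierPeriods-LinkTwistWrithe", crux]
def DegreeTransfer : Prop :=
  ∀ (n N : ℕ) (d : ℤ) (ε : Fin N → ℤ) (r r' : Literature.NumberTheory.Transcendental.KZ.IntegralRep n) (σ : Fin N → Set (Fin n → ℝ)) (Φ : Fin N → (Fin n → ℝ) → (Fin n → ℝ)) (Φ' : Fin N → (Fin n → ℝ) → ((Fin n → ℝ) →L[ℝ] (Fin n → ℝ))), (∀ k, Literature.ModelTheory.ExponentialFields.IsSemialgebraic ℚ (σ k)) → (∀ k, σ k ⊆ r.domain) → MeasureTheory.volume (r.domain \ ⋃ k, σ k) = 0 → (∀ k, Literature.NumberTheory.Transcendental.IsSemialgebraicMapOn ℚ (σ k) (Φ k)) → (∀ k, ∀ x ∈ σ k, HasFDerivWithinAt (Φ k) (Φ' k x) (σ k) x) → (∀ k, Set.InjOn (Φ k) (σ k)) → (∀ k, Φ k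 '' σ k ⊆ r'.domain) → (∀ᵐ y ∂(MeasureTheory.volume.restrict r'.domain), (∑ k : Fin N, (Φ k '' σ k).indicator (fun _ => ε k) y) = d) → (∀ x ∈ ⋃ k, σ k, r.integrand x = ∑ k : Fin N, (σ k).indicator (fun y => (ε k : ℝ) * (r'.integrand (Φ k y) * |(Φ' k y).det|)) x) → Literature.NumberTheory.Transcendental.KZ.of r - d • Literature.NumberTheory.Transcendental.KZ.of r' ∈ Literature.NumberTheory.Transcendental.KZ.relations

-- item stmt-KontsevichZagierPeriods-5246 · support · rank 5 · open · by planner — informal only, no Lean statement yet: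
--   [crux] HOPF INVARIANT SCALES BY k² INSIDE THE RULES (card W4 — the Grothendieck-primitive rung). Let
--   h : S³ → S² be the Hopf map, g_k : S² → S² the rational map of degree k induced by z ↦ z^k, f_k =
--   g_k ∘ h, ω = dA/4π. Whitehead1947: H(f) = ∫_{S³} α ∧ f*ω for ANY 1-form α with dα = f*ω, and H(f_k)
--   = k²·H(h) = k². CLAIM (k = 2 first, then 3): in the stereographic chart ℝ³ of S³ take α₁ = the
--   standard contact form (dα₁ = h*ω, α₁ ∧ dα₁ = c·dvol, cf. support ThreeSphereVolume) and α_k := k·α₁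
--   + h*β_k, where β_k is a REGULAR ALGEBRAIC 1-form on the real quadric S² = {x²+y²+z²=1}, definable
--   over ℚ,

/-- item stmt-KontsevichZagierPeriods-4307 · support · rank 9 · closed · proved by Summit.KontsevichZagierPeriods.LinkTwistWrithe.archimedesCoV_proof @ 484cbd02805f (prover) · by planner
sources: KontsevichZagier2001, BCR1998
[support] ARCHIMEDES' HAT-BOX THEOREM IS ONE MOVE OF RULE 2: the area density of S² in the
stereographic chart, [ℝ², 4/(1+|w|²)²], and the flat disc of radius 2, [{|w| < 2}, 1], differ by a
single changeOfVariablesRel instance, Φ(w) = 2w/√(1+|w|²) (inverse stereographic projection followed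
by Lambert's azimuthal equal-area map; a Nash diffeomorphism ℝ² → open disc of radius 2 with |det
Φ′| = 4/(1+|w|²)², graph {(w, y) : |y|²(1+|w|²) = 4|w|², y ∥ w, same direction} ℚ-semialgebraic).
This is the normalisation [S², dA] ~ 4π used by GaussLinkingHopfLink and by every degree computation
onto the sphere; provable now from the toolkit (IsSemialgebraicMapOn via the polynomial graph,
HasFDerivWithinAt of a C^∞ map, InjOn, image = open disc, Jacobian identity). [difficulty:
provable-now] -/
@[route_item "route-KontsevichZagierPeriods-LinkTwistWrithe"]
def ArchimedesCoV : Prop :=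
  ∀ (r r' : Literature.NumberTheory.Transcendental.KZ.IntegralRep 2), r.domain = Set.univ → Set.EqOn r.integrand (fun w : Fin 2 → ℝ => 4 / (1 + w 0 ^ 2 + w 1 ^ 2) ^ 2) r.domain → r'.domain = {w : Fin 2 → ℝ | w 0 ^ 2 + w 1 ^ 2 < 4} → Set.EqOn r'.integrand (fun _ => (1 : ℝ)) r'.domain → Literature.NumberTheory.Transcendental.KZ.of r - Literature.NumberTheory.Transcendental.KZ.of r' ∈ Literature.NumberTheory.Transcendental.KZ.changeOfVariablesRel

/-- item stmt-KontsevichZagierPeriods-4308 · support · rank 9 · closed · proved by Summit.KontsevichZagierPeriods.LinkTwistWrithe.threeSphereVolume_proof @ bd0588742737 (prover) · by planner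
sources: Whitehead1947, ArnoldKhesin1998, KontsevichZagier2001
[support] vol(S³) = 2π² INSIDE THE RULES, the normalisation of the Hopf rung (Whitehead's ∫α₁∧h*ω is
a rational multiple of it): the round volume density of S³ in the stereographic chart, [ℝ³,
8/(1+|x|²)³], minus twice the product of two unit discs, 2•[{w₀²+w₁²<1 ∧ w₂²+w₃²<1} ⊂ ℝ⁴, 1], lies
in KZ.relations. Suggested chain: the HOPF MAP with its fibre angle, x ↦ (stereo(h(x)), tan(ψ/2)),
is ONE ℚ-semialgebraic change of variables on a co-null open set ℝ³ → ℝ² × ℝ carrying 8/(1+|x|²)³ to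
2/((1+ρ²)²(1+w²)) (base S²(1/2) × fibre); ArchimedesCoV on the base factor gives [B(0,2) × ℝ,
1/(2(1+w²))]; on the fibre factor KZ's printed π-chain (w = tan-half-angle change of variables,
Newton–Leibniz with primitive y from the half-disc, reflection) reaches [B(0,2) × D⁺, 1] and
scaling/reflection moves give 2•[D × D, 1]. First dimension-3/4 derivation in the tree; failure
would refute the summit. [difficulty: M] -/
@[route_item "route-KontsevichZagierPeriods-LinkTwistWrithe"]
def ThreeSphereVolume : Prop :=
  ∀ (r : Literature.NumberTheory.Transcendental.KZ.IntegralRep 3) (r' : Literature.NumberTheory.Transcendental.KZ.IntegralRep 4), r.domain = Set.univ → Set.EqOn r.integrand (fun x : Fin 3 → ℝ => 8 / (1 + x 0 ^ 2 + x 1 ^ 2 + x 2 ^ 2) ^ 3) r.domain → r'.domain = {w : Fin 4 → ℝ | w 0 ^ 2 + w 1 ^ 2 < 1 ∧ w 2 ^ 2 + w 3 ^ 2 < 1} → Set.EqOn r'.integrand (fun _ => (1 : ℝ)) r'.domain → Literature.NumberTheory.Transcendental.KZ.of r - 2 • Literature.NumberTheory.Transcendental.KZ.of r' ∈ Literature.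NumberTheory.Transcendental.KZ.relations

/-- item stmt-KontsevichZagierPeriods-4309 · assembly · rank 1 · closed · proved by Summit.KontsevichZagierPeriods.LinkTwistWrithe.assembly_proof @ f427cf72cf92 (prover) · by planner
sources: KontsevichZagier2001, HuberMullerStach2017
[assembly] DegreeTransfer → DegreeKernel → KontsevichZagierPeriods (engine puts the signed-degree
relators inside KZ.relations; the enlarged kernel conjecture then gives the kernel form; kernel form
implies the summit). -/
@[route_item "route-KontsevichZagierPeriods-LinkTwistWrithe"]
def Assembly : Prop :=
  DegreeTransfer → DegreeKernel → KontsevichZagierPeriods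

/-! D-0027 §2.1 — DECIDING THEOREM (planner-authored via `route open/edit --closes-file`; by planner-rbadge-KontsevichZagierPeriods-LinkTwi-06ba7fda-g2-0 2026-08-15T16:10:43Z):
its hypotheses are this route's items and its conclusion the sub-problem Statement (glue_lint), and it elaborates with this file. -/

@[closes "route-KontsevichZagierPeriods-LinkTwistWrithe"] theorem closes (hT : DegreeTransfer) (hK : DegreeKernel) : KontsevichZagierPeriods := by
  intro n m r r' _ _ hv
  have h0 : Literature.NumberTheory.Transcendental.KZ.eval
      (Literature.NumberTheory.Transcendental.KZ.of r - Literature.NumberTheory.Transcendental.KZ.of r') = 0 := by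
    simp [Literature.NumberTheory.Transcendental.KZ.eval_of, hv]
  have hmem := hK _ h0
  refine SetLike.le_def.mp ((AddSubgroup.closure_le _).mpr ?_) hmem
  rintro c (((hc | hc) | hc) | hc)
  · exact Literature.NumberTheory.Transcendental.KZ.domainAddRel_subset_relations hc
  · exact Literature.NumberTheory.Transcendental.KZ.integrandAddRel_subset_relations hc
  · exact Literature.NumberTheory.Transcendental.KZ.newtonLeibnizRel_subset_relations hc
  · obtain ⟨n₀, N, d, ε, r₀, r₀', σ, Φ, Φ', h1, h2, h3, h4, h5, h6, h7, h8, h9, rfl⟩ := hc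
    exact hT n₀ N d ε r₀ r₀' σ Φ Φ' h1 h2 h3 h4 h5 h6 h7 h8 h9

end Summit.KontsevichZagierPeriods.KontsevichZagierPeriods.Theses.LinkTwistWrithe
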